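import Summits.QuantumFields.YangMills.Theorems.FemtoCutoffLadderThinningPlaquette
import HarnessLib

/-!
# Route `FemtoCutoffLadder` — the Wilson action of the thinned configuration: `S(thin L' U) ≤ 4 · S(U)` (`SU(2)`, every `d`, `L' ≤ L ≤ 2L'`)

Seat `ym-line-fcl-p3` g6 (2026-08-28).  Rung R2b1 = the RECORD-label femto transfer gap — NOT infinite volume, NOT the Clay mass gap; no summit and no
step of the route is proved by this module.

`FemtoCutoffLadderThinningPlaquette` bounds ONE plaquette of the thinned field by `4 ×` the deficits of the `≤ 4` fine plaquettes of its rectangle.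
Here the rectangles are shown to be DISJOINT — the fine base points `ι x' + s eᵢ + t eⱼ`, `s < thinSteps x'_i`, `t < thinSteps x'_j`, are pairwise
distinct over all `(x', s, t)` (`thinCoord_add_natCast_inj`: the windows `[ι a, ι a + thinSteps a)` tile the fine circle) — so summing gives the global
bound ★★ `wilsonAction_thin_le : wilsonAction su2Rep (thin L' U) ≤ 4 · wilsonAction su2Rep U`: thinning maps the fine small-ACTION region
`{S ≤ s}` into the coarse region `{S ≤ 4s}` (the magnetic weight `e^{−(β/2)S}` of the transfer kernel loses at most a factor `4` in the exponent).

* `thinCoord_val_add_lt`, `thinCoord_add_natCast_inj` — window arithmetic of the coordinate embedding;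
* `thinRect_injective` — injectivity of `(x', s, t) ↦ ι x' + s eᵢ + t eⱼ` on the windows (`i ≠ j`);
* `sum_thinRect_le` — for `f ≥ 0`, `Σ_{x'} Σ_{s,t in windows} f(ι x' + s eᵢ + t eⱼ) ≤ Σ_y f(y)`;
* `sum_plaquette_thin_le` (per orientation), `wilsonAction_su2Rep_eq_sum_orient`, ★★ `wilsonAction_thin_le`.

No definitions, no named facts, no `sorry`.
-/

set_option autoImplicit false

noncomputable section

open Literature.MathematicalPhysics.QuantumFieldTheory
open Literature.MathematicalPhysics.QuantumLattice

namespace Summit.QuantumFields.YangMills.Theorems.FemtoCutoffLadder.Thinning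

open Summit.QuantumFields.YangMills.Theorems.FemtoTransferGap

section Windows

variable {L L' : ℕ} [NeZero L']

/-- The window of `a` stays inside one period: `ι(a) + s < L` for `s < thinSteps a`. [folklore] -/
theorem thinCoord_val_add_lt (hLL : L' ≤ L) (h2 : L ≤ 2 * L') (a : ZMod L') {s : ℕ} (hs : s < thinSteps L L' a) :
    (thinCoord L L' a).val + s < L := by
  have ha : a.val < L' := ZMod.val_lt a
  rw [thinCoord_val hLL]
  unfold thinSteps at hs
  split_ifs at hs <;> omega

/-- **The windows `[ι a, ι a + thinSteps a)` are pairwise disjoint** (they tile the fine circle): `ι a + s = ι a' + s'` with `s < thinSteps a`,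
`s' < thinSteps a'` forces `a = a'` and `s = s'`. [folklore] -/
theorem thinCoord_add_natCast_inj (hLL : L' ≤ L) (h2 : L ≤ 2 * L') {a a' : ZMod L'} {s s' : ℕ} (hs : s < thinSteps L L' a)
    (hs' : s' < thinSteps L L' a') (h : thinCoord L L' a + ((s : ℕ) : ZMod L) = thinCoord L L' a' + ((s' : ℕ) : ZMod L)) :
    a = a' ∧ s = s' := by
  have ha : a.val < L' := ZMod.val_lt a
  have ha' : a'.val < L' := ZMod.val_lt a'
  haveI : NeZero L := ⟨by have := NeZero.ne L'; omega⟩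
  have hlt := thinCoord_val_add_lt hLL h2 a hs
  have hlt' := thinCoord_val_add_lt hLL h2 a' hs'
  have hv : (thinCoord L L' a + ((s : ℕ) : ZMod L)).val = (thinCoord L L' a).val + s := by
    rw [ZMod.val_add, ZMod.val_natCast_of_lt (by omega : s < L), Nat.mod_eq_of_lt hlt]
  have hv' : (thinCoord L L' a' + ((s' : ℕ) : ZMod L)).val = (thinCoord L L' a').val + s' := by
    rw [ZMod.val_add, ZMod.val_natCast_of_lt (by omega : s' < L), Nat.mod_eq_of_lt hlt']
  have heq := congrArg ZMod.val h
  rw [hv, hv', thinCoord_val hLL, thinCoord_val hLL] at heq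
  have key : a.val = a'.val ∧ s = s' := by
    unfold thinSteps at hs hs'
    split_ifs at hs hs' <;> omega
  exact ⟨ZMod.val_injective L' key.1, key.2⟩

end Windows

section Rectangles

variable {d L L' : ℕ} [NeZero L']

/-- **The thinning rectangles are disjoint**: for `i ≠ j` the fine base point `ι x' + s eᵢ + t eⱼ` (`s < thinSteps x'_i`, `t < thinSteps x'_j`)
determines `(x', s, t)`. [folklore] -/
theorem thinRect_injective (hLL : L' ≤ L) (h2 : L ≤ 2 * L') {i j : Fin d} (hij : i ≠ j) {x' x'' : Site d L'} {s t s' t' : ℕ}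
    (hs : s < thinSteps L L' (x' i)) (ht : t < thinSteps L L' (x' j)) (hs' : s' < thinSteps L L' (x'' i)) (ht' : t' < thinSteps L L' (x'' j))
    (h : thinSite L x' + Pi.single i ((s : ℕ) : ZMod L) + Pi.single j ((t : ℕ) : ZMod L) =
      thinSite L x'' + Pi.single i ((s' : ℕ) : ZMod L) + Pi.single j ((t' : ℕ) : ZMod L)) :
    x' = x'' ∧ s = s' ∧ t = t' := by
  have hi := congrFun h i
  have hj := congrFun h j
  simp only [Pi.add_apply, Pi.single_eq_same, Pi.single_eq_of_ne hij.symm, Pi.single_eq_of_ne hij, add_zero, thinSite] at hi hj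
  obtain ⟨hxi, hss⟩ := thinCoord_add_natCast_inj hLL h2 hs hs' hi
  obtain ⟨hxj, htt⟩ := thinCoord_add_natCast_inj hLL h2 ht ht' hj
  refine ⟨?_, hss, htt⟩
  funext k
  by_cases hki : k = i
  · subst hki; exact hxi
  by_cases hkj : k = j
  · subst hkj; exact hxj
  have hk := congrFun h k
  simp only [Pi.add_apply, Pi.single_eq_of_ne hki, Pi.single_eq_of_ne hkj, add_zero, thinSite] at hk
  exact thinCoord_injective hLL hk

/-- **Summing a non-negative function over the thinning rectangles undercounts the fine sum**:
`Σ_{x'} Σ_{s < thinSteps x'_i} Σ_{t < thinSteps x'_j} f(ι x' + s eᵢ + t eⱼ) ≤ Σ_y f(y)` for `f ≥ 0`, `i ≠ j` (the base points are pairwise distinct,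
`thinRect_injective`). [folklore] -/
theorem sum_thinRect_le [NeZero L] (hLL : L' ≤ L) (h2 : L ≤ 2 * L') {i j : Fin d} (hij : i ≠ j) (f : Site d L → ℝ) (hf : ∀ y, 0 ≤ f y) :
    ∑ x' : Site d L', ∑ s ∈ Finset.range (thinSteps L L' (x' i)), ∑ t ∈ Finset.range (thinSteps L L' (x' j)),
        f (thinSite L x' + Pi.single i ((s : ℕ) : ZMod L) + Pi.single j ((t : ℕ) : ZMod L)) ≤
      ∑ y : Site d L, f y := by
  classical
  set T : Finset (Σ _ : Site d L', ℕ × ℕ) :=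
    (Finset.univ : Finset (Site d L')).sigma fun x' => Finset.range (thinSteps L L' (x' i)) ×ˢ Finset.range (thinSteps L L' (x' j)) with hT
  set Φ : (Σ _ : Site d L', ℕ × ℕ) → Site d L :=
    fun z => thinSite L z.1 + Pi.single i ((z.2.1 : ℕ) : ZMod L) + Pi.single j ((z.2.2 : ℕ) : ZMod L) with hΦ
  have hLHS : ∑ x' : Site d L', ∑ s ∈ Finset.range (thinSteps L L' (x' i)), ∑ t ∈ Finset.range (thinSteps L L' (x' j)),
      f (thinSite L x' + Pi.single i ((s : ℕ) : ZMod L) + Pi.single j ((t : ℕ) : ZMod L)) = ∑ z ∈ T, f (Φ z) := by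
    rw [hT, Finset.sum_sigma]
    refine Finset.sum_congr rfl fun x' _ => ?_
    rw [Finset.sum_product]
  have hinj : ∀ z ∈ T, ∀ z' ∈ T, Φ z = Φ z' → z = z' := by
    rintro ⟨x', s, t⟩ hz ⟨x'', s', t'⟩ hz' hzz
    simp only [hT, Finset.mem_sigma, Finset.mem_univ, Finset.mem_product, Finset.mem_range, true_and] at hz hz'
    obtain ⟨hx, hs, ht⟩ := thinRect_injective hLL h2 hij hz.1 hz.2 hz'.1 hz'.2 hzz
    subst hx; subst hs; subst ht; rfl
  rw [hLHS, ← Finset.sum_image hinj]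
  exact Finset.sum_le_sum_of_subset_of_nonneg (Finset.subset_univ _) fun y _ _ => hf y

/-- Per orientation: `Σ_{x'} e(thin L' U; x'; i, j) ≤ 4 · Σ_y e(U; y; i, j)` for `i ≠ j` (per-plaquette bound summed over the disjoint rectangles).
[folklore] -/
theorem sum_plaquette_thin_le [NeZero L] (hLL : L' ≤ L) (h2 : L ≤ 2 * L') (U : GaugeConfig d L SU2) {i j : Fin d} (hij : i ≠ j) :
    ∑ x' : Site d L', (2 - ((su2Rep (plaquetteHolonomy (thin L' U) x' i j)).trace).re) ≤
      4 * ∑ y : Site d L, (2 - ((su2Rep (plaquetteHolonomy U y i j)).trace).re) := by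
  have h1 : ∑ x' : Site d L', (2 - ((su2Rep (plaquetteHolonomy (thin L' U) x' i j)).trace).re) ≤
      ∑ x' : Site d L', 4 * ∑ s ∈ Finset.range (thinSteps L L' (x' i)), ∑ t ∈ Finset.range (thinSteps L L' (x' j)),
        (2 - ((su2Rep (plaquetteHolonomy U
          (thinSite L x' + Pi.single i ((s : ℕ) : ZMod L) + Pi.single j ((t : ℕ) : ZMod L)) i j)).trace).re) :=
    Finset.sum_le_sum fun x' _ => two_sub_re_trace_plaquette_thin_le hLL h2 U x' hij
  have h2' := sum_thinRect_le hLL h2 hij (fun y => 2 - ((su2Rep (plaquetteHolonomy U y i j)).trace).re)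
    fun y => two_sub_re_trace_nonneg _
  rw [← Finset.mul_sum] at h1
  linarith

/-- The Wilson action of `SU(2)` as a sum over orientations `i < j` and base points. [folklore] -/
theorem wilsonAction_su2Rep_eq_sum_orient {M : ℕ} [NeZero M] (V : GaugeConfig d M SU2) :
    wilsonAction su2Rep V =
      ∑ q : {p : Fin d × Fin d // p.1 < p.2}, ∑ y : Site d M, (2 - ((su2Rep (plaquetteHolonomy V y q.1.1 q.1.2)).trace).re) := by
  unfold wilsonAction
  rw [Fintype.sum_prod_type_right]
  simp only [Nat.cast_ofNat]

/-- ★★ **The Wilson action of the thinned configuration is at most four times the fine Wilson action**: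
`S(thin L' U) ≤ 4 · S(U)` for `SU(2)`, every dimension `d`, every `L' ≤ L ≤ 2L'` (per plaquette `FemtoCutoffLadderThinningPlaquette`, summed over the
disjoint thinning rectangles, orientation by orientation).  Thinning maps small-action fine fields to small-action coarse fields. [folklore] -/
theorem wilsonAction_thin_le [NeZero L] (hLL : L' ≤ L) (h2 : L ≤ 2 * L') (U : GaugeConfig d L SU2) :
    wilsonAction su2Rep (thin L' U) ≤ 4 * wilsonAction su2Rep U := by
  rw [wilsonAction_su2Rep_eq_sum_orient, wilsonAction_su2Rep_eq_sum_orient, Finset.mul_sum]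
  exact Finset.sum_le_sum fun q _ => sum_plaquette_thin_le hLL h2 U (ne_of_lt q.2)

end Rectangles

end Summit.QuantumFields.YangMills.Theorems.FemtoCutoffLadder.Thinning

end
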